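import Literature.GroupTheory.CombinatorialGroupTheory.PuncturedSurfaceGroupTwoComponentBases
import HarnessLib

/-!
# A free basis of `Γ_{g,r}` carrying the three subsurface groups of a three-component chain degeneration

Topic `Literature/GroupTheory/CombinatorialGroupTheory`; theorems only.  `Γ_{g,r} = ⟨a_i, b_i, c_j ∣
∏_i [a_i,b_i] · c_0 ⋯ c_{r−1}⟩` (`PuncturedSurfaceGroup g r`, [SemiAnbd] Example 2.10
[cite: MochizukiSemiAnbd2006, Ex. 2.10 p.31]).  Sequel of `PuncturedSurfaceGroupNodeLoopBasis.lean`
(abc-iut-f-166) and `PuncturedSurfaceGroupTwoComponentBases.lean` (abc-iut-f-164).  THREE-COMPONENT CHAIN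
degeneration `C₀ —ν_A— C_mid —ν_B— C₁` of a pointed curve of type `(g, r)`: handles `i < g₀` and cusps
`j ≥ s₂` on `C₀`, handles `g₀ ≤ i < g₁` and cusps `s₁ ≤ j < s₂` on `C_mid`, handles `i ≥ g₁` and cusps
`j < s₁` on `C₁`; the two node loops are the consecutive cyclic sub-words of the relator

  `ε_A = (c_{s₂} ⋯ c_{r−1}) · ∏_{i<g₀} [a_i, b_i]`   (around `C₀`),
  `η   = (c_{s₁} ⋯ c_{r−1}) · ∏_{i<g₁} [a_i, b_i]`   (around `C₀ ∪ C_mid`, i.e. the loop of `ν_B`),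

both of the node-loop shape of the two-component case (parameters `(g₀, s₂)` resp. `(g₁, s₁)`).

* `cusp_prod_ge_split`, `comm_prod_lt_split`, `cusp_prod_window_peel` — window bookkeeping;
  `secondLoop_eq_c_mul` — `η = c_{s₁} · ((c_{s₁+1}⋯c_{s₂−1}) · ε_A · ∏_{g₀≤i<g₁}[a_i,b_i])`;
* `exists_freeGroupBasis_insert_nodeLoop` — the Nielsen move `c_s ↦ ε` at slot `s − 1` on ANY free basis
  whose members at the slots `≥ s − 1` are `c_s, c_{s+1}, …` (generalising abc-iut-f-166's construction);
* `exists_freeGroupBasis_insert_secondLoop` — the Nielsen move `c_{s₁} ↦ η` at slot `s₁ − 1` on any free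
  basis carrying `c_{s₁}, …, c_{s₂−1}` at the slots `s₁ − 1, …, s₂ − 2` and `ε_A` at slot `s₂ − 1`;
* the resulting basis `B = (a_i, b_i, c_1, …, c_{s₁−1}, η, c_{s₁+1}, …, c_{s₂−1}, ε_A, c_{s₂+1}, …, c_{r−1})`
  carries all three subsurface groups as sub-basis closures (`PuncturedSurfaceGroupThreeChainClosures.lean`).

Input of [CombGC] Prop. 1.2 / 1.5 at three-component chain data (`PSCThreeChainShape.lean`).  Elementary
combinatorial group theory (Lyndon–Schupp I.3); nothing here concerns [IUTchIII].
-/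

namespace Literature.GroupTheory.CombinatorialGroupTheory

namespace PuncturedSurfaceGroup

variable {g r : ℕ}

/-! ### Window bookkeeping -/

/-- `c_{s₁} ⋯ c_{r−1} = (c_{s₁} ⋯ c_{s₂−1}) · (c_{s₂} ⋯ c_{r−1})` for `s₁ ≤ s₂`.
[cite: MochizukiSemiAnbd2006, Ex. 2.10 p.31] -/
theorem cusp_prod_ge_split (s₁ s₂ : ℕ) (h : s₁ ≤ s₂) :
    ((List.finRange r).map fun j : Fin r => if s₁ ≤ (j : ℕ) then c (g := g) j else 1).prod =
      ((List.finRange r).map fun j : Fin r =>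
          if s₁ ≤ (j : ℕ) ∧ (j : ℕ) < s₂ then c (g := g) j else 1).prod *
        ((List.finRange r).map fun j : Fin r => if s₂ ≤ (j : ℕ) then c (g := g) j else 1).prod := by
  rw [prod_map_finRange_split r s₂ (fun j : Fin r => if s₁ ≤ (j : ℕ) then c (g := g) j else 1)]
  have e1 : (fun i : Fin r => if (i : ℕ) < s₂ then (if s₁ ≤ (i : ℕ) then c (g := g) i else 1) else 1) =
      fun i : Fin r => if s₁ ≤ (i : ℕ) ∧ (i : ℕ) < s₂ then c (g := g) i else 1 := by
    funext i
    by_cases h1 : (i : ℕ) < s₂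
    · by_cases h2 : s₁ ≤ (i : ℕ)
      · rw [if_pos h1, if_pos h2, if_pos ⟨h2, h1⟩]
      · rw [if_pos h1, if_neg h2, if_neg (fun h' => h2 h'.1)]
    · rw [if_neg h1, if_neg (fun h' => h1 h'.2)]
  have e2 : (fun i : Fin r => if s₂ ≤ (i : ℕ) then (if s₁ ≤ (i : ℕ) then c (g := g) i else 1) else 1) =
      fun i : Fin r => if s₂ ≤ (i : ℕ) then c (g := g) i else 1 := by
    funext i
    by_cases h1 : s₂ ≤ (i : ℕ)
    · rw [if_pos h1, if_pos h1, if_pos (le_trans h h1)]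
    · rw [if_neg h1, if_neg h1]
  rw [e1, e2]

/-- `∏_{i<g₁}[a_i,b_i] = ∏_{i<g₀}[a_i,b_i] · ∏_{g₀≤i<g₁}[a_i,b_i]` for `g₀ ≤ g₁`.
[cite: MochizukiSemiAnbd2006, Ex. 2.10 p.31] -/
theorem comm_prod_lt_split (g₀ g₁ : ℕ) (h : g₀ ≤ g₁) :
    ((List.finRange g).map fun i : Fin g => if (i : ℕ) < g₁ then
        a (r := r) i * b i * (a i)⁻¹ * (b i)⁻¹ else 1).prod =
      ((List.finRange g).map fun i : Fin g => if (i : ℕ) < g₀ then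
          a (r := r) i * b i * (a i)⁻¹ * (b i)⁻¹ else 1).prod *
        ((List.finRange g).map fun i : Fin g => if g₀ ≤ (i : ℕ) ∧ (i : ℕ) < g₁ then
          a (r := r) i * b i * (a i)⁻¹ * (b i)⁻¹ else 1).prod := by
  rw [prod_map_finRange_split g g₀ (fun i : Fin g => if (i : ℕ) < g₁ then
    a (r := r) i * b i * (a i)⁻¹ * (b i)⁻¹ else 1)]
  have e1 : (fun i : Fin g => if (i : ℕ) < g₀ then (if (i : ℕ) < g₁ then
        a (r := r) i * b i * (a i)⁻¹ * (b i)⁻¹ else 1) else 1) =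
      fun i : Fin g => if (i : ℕ) < g₀ then a (r := r) i * b i * (a i)⁻¹ * (b i)⁻¹ else 1 := by
    funext i
    by_cases h1 : (i : ℕ) < g₀
    · rw [if_pos h1, if_pos h1, if_pos (lt_of_lt_of_le h1 h)]
    · rw [if_neg h1, if_neg h1]
  have e2 : (fun i : Fin g => if g₀ ≤ (i : ℕ) then (if (i : ℕ) < g₁ then
        a (r := r) i * b i * (a i)⁻¹ * (b i)⁻¹ else 1) else 1) =
      fun i : Fin g => if g₀ ≤ (i : ℕ) ∧ (i : ℕ) < g₁ then a (r := r) i * b i * (a i)⁻¹ * (b i)⁻¹ else 1 := by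
    funext i
    by_cases h1 : g₀ ≤ (i : ℕ)
    · by_cases h2 : (i : ℕ) < g₁
      · rw [if_pos h1, if_pos h2, if_pos ⟨h1, h2⟩]
      · rw [if_pos h1, if_neg h2, if_neg (fun h' => h2 h'.2)]
    · rw [if_neg h1, if_neg (fun h' => h1 h'.1)]
  rw [e1, e2]

/-- `c_{s₁} ⋯ c_{s₂−1} = c_{s₁} · (c_{s₁+1} ⋯ c_{s₂−1})` for `s₁ < s₂`, `s₁ < r`.
[cite: MochizukiSemiAnbd2006, Ex. 2.10 p.31] -/
theorem cusp_prod_window_peel (s₁ s₂ : ℕ) (h : s₁ < s₂) (hr : s₁ < r) :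
    ((List.finRange r).map fun j : Fin r =>
        if s₁ ≤ (j : ℕ) ∧ (j : ℕ) < s₂ then c (g := g) j else 1).prod =
      c ⟨s₁, hr⟩ * ((List.finRange r).map fun j : Fin r =>
        if s₁ + 1 ≤ (j : ℕ) ∧ (j : ℕ) < s₂ then c (g := g) j else 1).prod := by
  classical
  rw [prod_map_finRange_split r (s₁ + 1)
    (fun j : Fin r => if s₁ ≤ (j : ℕ) ∧ (j : ℕ) < s₂ then c (g := g) j else 1)]
  have e1 : (fun i : Fin r => if (i : ℕ) < s₁ + 1 then
        (if s₁ ≤ (i : ℕ) ∧ (i : ℕ) < s₂ then c (g := g) i else 1) else 1) =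
      fun i : Fin r => if i = ⟨s₁, hr⟩ then c (g := g) i else 1 := by
    funext i
    by_cases h' : i = ⟨s₁, hr⟩
    · subst h'
      rw [if_pos rfl, if_pos (show ((⟨s₁, hr⟩ : Fin r) : ℕ) < s₁ + 1 by change s₁ < s₁ + 1; omega),
        if_pos ⟨le_rfl, show ((⟨s₁, hr⟩ : Fin r) : ℕ) < s₂ by change s₁ < s₂; omega⟩]
    · have h'' : (i : ℕ) ≠ s₁ := fun e => h' (Fin.ext e)
      rw [if_neg h']
      by_cases h2 : (i : ℕ) < s₁ + 1
      · rw [if_pos h2, if_neg (by omega)]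
      · rw [if_neg h2]
  have e2 : (fun i : Fin r => if s₁ + 1 ≤ (i : ℕ) then
        (if s₁ ≤ (i : ℕ) ∧ (i : ℕ) < s₂ then c (g := g) i else 1) else 1) =
      fun i : Fin r => if s₁ + 1 ≤ (i : ℕ) ∧ (i : ℕ) < s₂ then c (g := g) i else 1 := by
    funext i
    by_cases h1 : s₁ + 1 ≤ (i : ℕ)
    · by_cases h2 : (i : ℕ) < s₂
      · rw [if_pos h1, if_pos ⟨by omega, h2⟩, if_pos ⟨h1, h2⟩]
      · rw [if_pos h1, if_neg (fun h' => h2 h'.2), if_neg (fun h' => h2 h'.2)]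
    · rw [if_neg h1, if_neg (fun h' => h1 h'.1)]
  rw [e1, e2, prod_map_finRange_ite_eq_single]

/-! ### The chain: two node loops in one basis -/

section Chain

variable {r' : ℕ} {g₀ g₁ s₁ s₂ : ℕ} {εA η : PuncturedSurfaceGroup g (r' + 1)}
  {B : FreeGroupBasis ((Fin g × Bool) ⊕ Fin r') (PuncturedSurfaceGroup g (r' + 1))}
  (hεA : εA = ((List.finRange (r' + 1)).map fun j : Fin (r' + 1) =>
        if s₂ ≤ (j : ℕ) then c (g := g) j else 1).prod *
      ((List.finRange g).map fun i : Fin g => if (i : ℕ) < g₀ then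
        a (r := r' + 1) i * b i * (a i)⁻¹ * (b i)⁻¹ else 1).prod)
  (hη : η = ((List.finRange (r' + 1)).map fun j : Fin (r' + 1) =>
        if s₁ ≤ (j : ℕ) then c (g := g) j else 1).prod *
      ((List.finRange g).map fun i : Fin g => if (i : ℕ) < g₁ then
        a (r := r' + 1) i * b i * (a i)⁻¹ * (b i)⁻¹ else 1).prod)
  (ha : ∀ i, B (Sum.inl (i, false)) = a i) (hb : ∀ i, B (Sum.inl (i, true)) = b i)

include hεA hη in
/-- **The second loop through the first**: `η = c_{s₁} · ((c_{s₁+1}⋯c_{s₂−1}) · ε_A · ∏_{g₀≤i<g₁}[a_i,b_i])`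
for `g₀ ≤ g₁`, `s₁ < s₂`, `s₁ ≤ r'`. [cite: MochizukiSemiAnbd2006, Ex. 2.10 p.31] -/
theorem secondLoop_eq_c_mul (hg : g₀ ≤ g₁) (hs : s₁ < s₂) (hs₁ : s₁ < r' + 1) :
    η = c ⟨s₁, hs₁⟩ * (((List.finRange (r' + 1)).map fun j : Fin (r' + 1) =>
        if s₁ + 1 ≤ (j : ℕ) ∧ (j : ℕ) < s₂ then c (g := g) j else 1).prod * εA *
      ((List.finRange g).map fun i : Fin g => if g₀ ≤ (i : ℕ) ∧ (i : ℕ) < g₁ then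
        a (r := r' + 1) i * b i * (a i)⁻¹ * (b i)⁻¹ else 1).prod) := by
  rw [hη, hεA, cusp_prod_ge_split (g := g) s₁ s₂ hs.le, comm_prod_lt_split (r := r' + 1) g₀ g₁ hg,
    cusp_prod_window_peel (g := g) s₁ s₂ hs hs₁]
  simp only [mul_assoc]

include hεA ha hb in
/-- **Inserting the node loop `ε_A` at slot `s₂ − 1`** (Nielsen move `c_{s₂} ↦ ε_A = c_{s₂} · u`) on ANY free
basis `B` whose members at the slots `s₂ − 1, s₂, …` are `c_{s₂}, c_{s₂+1}, …` (and whose handle members are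
the `a_i`, `b_i`): a free basis agreeing with `B` off slot `s₂ − 1` and carrying `ε_A` there.
[cite: LyndonSchupp2001, I.3 Prop 3.8] -/
theorem exists_freeGroupBasis_insert_nodeLoop (hs1 : 1 ≤ s₂) (hsr : s₂ ≤ r')
    (hκ : B (Sum.inr ⟨s₂ - 1, by omega⟩) = c ⟨s₂, by omega⟩)
    (htail : ∀ j : Fin r', s₂ + 1 ≤ (j : ℕ) + 1 → B (Sum.inr j) = c (Fin.succ j)) :
    ∃ B' : FreeGroupBasis ((Fin g × Bool) ⊕ Fin r') (PuncturedSurfaceGroup g (r' + 1)),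
      B' (Sum.inr ⟨s₂ - 1, by omega⟩) = εA ∧ ∀ x, x ≠ Sum.inr ⟨s₂ - 1, by omega⟩ → B' x = B x := by
  classical
  set κ : (Fin g × Bool) ⊕ Fin r' := Sum.inr ⟨s₂ - 1, by omega⟩ with hκdef
  have hs₂ : s₂ < r' + 1 := by omega
  set u : PuncturedSurfaceGroup g (r' + 1) :=
    ((List.finRange (r' + 1)).map fun j : Fin (r' + 1) => if s₂ + 1 ≤ (j : ℕ) then c (g := g) j else 1).prod *
      ((List.finRange g).map fun i : Fin g => if (i : ℕ) < g₀ then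
        a (r := r' + 1) i * b i * (a i)⁻¹ * (b i)⁻¹ else 1).prod with hu
  have hεu : εA = B κ * u := by rw [hκ, hu]; exact nodeLoop_eq_c_mul g₀ s₂ hs₂ εA hεA
  have hmem : ∀ x : (Fin g × Bool) ⊕ Fin r', x ≠ κ → B x ∈ Subgroup.closure (B '' {j | j ≠ κ}) :=
    fun x hx => Subgroup.subset_closure ⟨x, hx, rfl⟩
  have haK : ∀ i, a (r := r' + 1) i ∈ Subgroup.closure (B '' {j | j ≠ κ}) := fun i => by
    rw [← ha i]; exact hmem _ (by simp [hκdef])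
  have hbK : ∀ i, b (r := r' + 1) i ∈ Subgroup.closure (B '' {j | j ≠ κ}) := fun i => by
    rw [← hb i]; exact hmem _ (by simp [hκdef])
  have hcK : ∀ j : Fin (r' + 1), s₂ + 1 ≤ (j : ℕ) → c (g := g) j ∈ Subgroup.closure (B '' {j | j ≠ κ}) := by
    intro j hj
    have hj0 : (j : ℕ) ≠ 0 := by omega
    have e1 : B (Sum.inr (j.pred (fun h => hj0 (by rw [h]; rfl)))) = c j := by
      rw [htail _ (by rw [Fin.val_pred]; omega), Fin.succ_pred]
    rw [← e1]
    refine hmem _ ?_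
    simp only [hκdef, Ne, Sum.inr.injEq, Fin.ext_iff, Fin.val_pred]
    omega
  have huK : u ∈ Subgroup.closure (B '' {j | j ≠ κ}) := by
    rw [hu]
    exact Subgroup.mul_mem _ (prod_map_finRange_ite_mem _ _ _ _ hcK)
      (comm_prod_ite_mem _ _ (fun i _ => haK i) (fun i _ => hbK i))
  obtain ⟨B', hB'κ, hB'⟩ := exists_freeGroupBasis_update_mul B κ u huK
  exact ⟨B', by rw [hB'κ, ← hεu], hB'⟩

include hεA hη ha hb in
/-- **Inserting the second loop `η` at slot `s₁ − 1`** (Nielsen move `c_{s₁} ↦ η = c_{s₁} · u`,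
`u = (c_{s₁+1}⋯c_{s₂−1}) ε_A ∏_{g₀≤i<g₁}[a_i,b_i]`) on any free basis `B` carrying `c_{s₁}, …, c_{s₂−1}` at the
slots `s₁ − 1, …, s₂ − 2` and `ε_A` at slot `s₂ − 1`: a free basis agreeing with `B` off slot `s₁ − 1` and
carrying `η` there. [cite: LyndonSchupp2001, I.3 Prop 3.8] -/
theorem exists_freeGroupBasis_insert_secondLoop (hg : g₀ ≤ g₁) (hs1 : 1 ≤ s₁) (hs : s₁ < s₂)
    (hsr : s₂ ≤ r')
    (hmid : ∀ j : Fin r', s₁ ≤ (j : ℕ) + 1 → (j : ℕ) + 1 < s₂ → B (Sum.inr j) = c (Fin.succ j))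
    (hA : B (Sum.inr ⟨s₂ - 1, by omega⟩) = εA) :
    ∃ B' : FreeGroupBasis ((Fin g × Bool) ⊕ Fin r') (PuncturedSurfaceGroup g (r' + 1)),
      B' (Sum.inr ⟨s₁ - 1, by omega⟩) = η ∧ ∀ x, x ≠ Sum.inr ⟨s₁ - 1, by omega⟩ → B' x = B x := by
  classical
  set κ : (Fin g × Bool) ⊕ Fin r' := Sum.inr ⟨s₁ - 1, by omega⟩ with hκdef
  have hs₁ : s₁ < r' + 1 := by omega
  have hκ : B κ = c ⟨s₁, hs₁⟩ := by
    rw [hκdef, hmid _ (by simp only; omega) (by simp only; omega)]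
    congr 1; ext; simp only [Fin.val_succ]; omega
  set u : PuncturedSurfaceGroup g (r' + 1) :=
    ((List.finRange (r' + 1)).map fun j : Fin (r' + 1) =>
        if s₁ + 1 ≤ (j : ℕ) ∧ (j : ℕ) < s₂ then c (g := g) j else 1).prod * εA *
      ((List.finRange g).map fun i : Fin g => if g₀ ≤ (i : ℕ) ∧ (i : ℕ) < g₁ then
        a (r := r' + 1) i * b i * (a i)⁻¹ * (b i)⁻¹ else 1).prod with hu
  have hηu : η = B κ * u := by rw [hκ, hu]; exact secondLoop_eq_c_mul hεA hη hg hs hs₁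
  have hmem : ∀ x : (Fin g × Bool) ⊕ Fin r', x ≠ κ → B x ∈ Subgroup.closure (B '' {j | j ≠ κ}) :=
    fun x hx => Subgroup.subset_closure ⟨x, hx, rfl⟩
  have haK : ∀ i, a (r := r' + 1) i ∈ Subgroup.closure (B '' {j | j ≠ κ}) := fun i => by
    rw [← ha i]; exact hmem _ (by simp [hκdef])
  have hbK : ∀ i, b (r := r' + 1) i ∈ Subgroup.closure (B '' {j | j ≠ κ}) := fun i => by
    rw [← hb i]; exact hmem _ (by simp [hκdef])
  have hAK : εA ∈ Subgroup.closure (B '' {j | j ≠ κ}) := by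
    rw [← hA]
    refine hmem _ ?_
    simp only [hκdef, Ne, Sum.inr.injEq, Fin.ext_iff]
    omega
  have hcK : ∀ j : Fin (r' + 1), s₁ + 1 ≤ (j : ℕ) ∧ (j : ℕ) < s₂ →
      c (g := g) j ∈ Subgroup.closure (B '' {j | j ≠ κ}) := by
    rintro j ⟨hj1, hj2⟩
    have hj0 : (j : ℕ) ≠ 0 := by omega
    have e1 : B (Sum.inr (j.pred (fun h => hj0 (by rw [h]; rfl)))) = c j := by
      rw [hmid _ (by rw [Fin.val_pred]; omega) (by rw [Fin.val_pred]; omega), Fin.succ_pred]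
    rw [← e1]
    refine hmem _ ?_
    simp only [hκdef, Ne, Sum.inr.injEq, Fin.ext_iff, Fin.val_pred]
    omega
  have huK : u ∈ Subgroup.closure (B '' {j | j ≠ κ}) := by
    rw [hu]
    exact Subgroup.mul_mem _ (Subgroup.mul_mem _ (prod_map_finRange_ite_mem _ _ _ _ hcK) hAK)
      (comm_prod_ite_mem _ _ (fun i _ => haK i) (fun i _ => hbK i))
  obtain ⟨B', hB'κ, hB'⟩ := exists_freeGroupBasis_update_mul B κ u huK
  exact ⟨B', by rw [hB'κ, ← hηu], hB'⟩

end Chain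

end PuncturedSurfaceGroup

end Literature.GroupTheory.CombinatorialGroupTheory
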